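import Mathlib
import Summits.ResolutionOfSingularities.ResolutionOfSingularities.Theorems.RadicialJungCleanModelsCleanPermissibleSeq
import Literature.AlgebraicGeometry.Resolution.RsopPartOfRegularSequence
import HarnessLib

/-!
# Route `RadicialJung`, crux `CleanModels` (stmt-ResolutionOfSingularities-15917), line `Sketch` rev 18, stub 4e
# `stub_cleanPrincipalization3`: CRITERIA for clean-permissibility (normal crossings with the clean divisor ⇒ permissible)

How a future prover of the research residue X44c of 4e (memo `Cruxes/CleanModels/Lines/Sketch-memo-4e-cleanPermissible.md`) VERIFIES
`CleanPermissibleAt` (✓ p683310) at a point of a regular centre: it suffices that the charged coordinates of a loosely clean representative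
SPLIT into those vanishing on the centre and those transversal to it — the normal-crossings condition between the centre `V(J)` and the
clean divisor, in the local form of Bierstone–Grigoriev–Milman–Włodarczyk Def. 3.1.3 (2) — because then ONE regular system of parameters is
adapted to both (tree ✓ `exists_isRsopPart_append_span_eq`, `RsopPartOfRegularSequence.lean`: `(a, c, b)` with `J = (a, c)`).

* `cleanPermissibleAt_of_split` — `R` regular local with `R/J` regular; a non-trivial representative `Σ c_j^p G^j = f(u · ∏ a_k^{α_k} · ∏ b_k^{β_k})`
  with `u` a unit, `a : Fin p₁ → J` part of a regular system of parameters (the charged components CONTAINING the centre), `b : Fin q → 𝔪` whose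
  images in `R/J` are part of a regular system of parameters of `R/J` (the charged components TRANSVERSAL to the centre), some exponent prime
  to `p` ⟹ `CleanPermissibleAt p f G J`.  Covers: a curve inside one clean component (`q = 0`), a double curve (`p₁ = 2`), a curve in `H_a`
  transversal to `H_b`, a curve off the divisor transversal to one component (`p₁ = 0, q = 1`), the created lines `L ⊂ E` of the memo off their
  vertices.
* `cleanPermissibleAt_of_unit` — form (2) (unit with residue not a `p`-th power) is clean-permissible for every `J` with `R/J` regular.

Honest framing: OURS, plumbing over Matsumura 14.2; nothing here proves resolution in characteristic `p` or any case of `CleanModels`.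
-/

noncomputable section

set_option linter.dupNamespace false -- mandated namespace of this single-conjunct summit

open IsLocalRing
open Literature.AlgebraicGeometry.Resolution

namespace Summit.ResolutionOfSingularities.ResolutionOfSingularities.Theorems.RadicialJung.CleanModels

universe u

/-- The range of an appended family (local copy of `range_fin_append`). [folklore] -/
private theorem range_append' {α : Type*} {m n : ℕ} (u : Fin m → α) (v : Fin n → α) :
    Set.range (Fin.append u v) = Set.range u ∪ Set.range v := by
  ext a
  constructor
  · rintro ⟨i, rfl⟩
    induction i using Fin.addCases with
    | left j => exact Or.inl ⟨j, by simp⟩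
    | right k => exact Or.inr ⟨k, by simp⟩
  · rintro (⟨j, rfl⟩ | ⟨k, rfl⟩)
    · exact ⟨Fin.castAdd n j, by simp⟩
    · exact ⟨Fin.natAdd m k, by simp⟩

/-- Products over an appended family with appended exponents split. [folklore] -/
private theorem prod_append_pow {M : Type*} [CommMonoid M] {m n : ℕ} (u : Fin m → M) (v : Fin n → M) (α : Fin m → ℕ)
    (β : Fin n → ℕ) : ∏ i, Fin.append u v i ^ Fin.append α β i = (∏ i, u i ^ α i) * ∏ i, v i ^ β i := by
  rw [Fin.prod_univ_add]
  simp only [Fin.append_left, Fin.append_right]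

/-- **Normal crossings with the clean divisor ⇒ clean-permissible.**  Let `R` be a regular local ring read in `F` by `f`, `J` an ideal with
`R/J` regular (a regular centre through the closed point), and suppose some non-trivial representative `Σ_j c_j^p G^j` of the `F^p`-line of `G` is
`f(u · ∏_k a_k^{α_k} · ∏_k b_k^{β_k})` with `u` a unit, `a : Fin p₁ → R` part of a regular system of parameters with all `a_k ∈ J`, `b : Fin q → 𝔪`
with `(b_k mod J)` part of a regular system of parameters of `R/J`, and some `α_k` or `β_k` prime to `p`.  Then the line is clean-permissible
at `R` for `J`: by `exists_isRsopPart_append_span_eq` there is `c` with `(a, c, b)` part of a regular system of parameters and `J = (a, c)`;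
complete it to `(a, c, b, y)` and put exponent `0` on `c` and `y`. [cite: Matsumura1987, Thm. 14.2] [cite: BierstoneGrigorievMilmanWlodarczyk2011, Def. 3.1.3 (2)] -/
theorem cleanPermissibleAt_of_split {R F : Type u} [CommRing R] [IsRegularLocalRing R] [CommRing F] (p : ℕ) (f : R →+* F)
    (G : F) (J : Ideal R) [IsRegularLocalRing (R ⧸ J)] (cc : Fin p → F) (hcc : ∃ j : Fin p, (j : ℕ) ≠ 0 ∧ cc j ≠ 0)
    {p₁ q : ℕ} (a : Fin p₁ → R) (b : Fin q → R) (ha : IsRsopPart a) (haJ : ∀ k, a k ∈ J)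
    (hbm : ∀ k, b k ∈ maximalIdeal R)
    (hb : haveI : IsLocalRing (R ⧸ J) := inferInstance; IsRsopPart (Ideal.Quotient.mk J ∘ b))
    (α : Fin p₁ → ℕ) (β : Fin q → ℕ) (hαβ : (∃ k, ¬ p ∣ α k) ∨ (∃ k, ¬ p ∣ β k)) (u : R) (hu : IsUnit u)
    (hX : (∑ j : Fin p, cc j ^ p * G ^ (j : ℕ)) = f (u * (∏ k, a k ^ α k) * ∏ k, b k ^ β k)) :
    CleanPermissibleAt p f G J := by
  classical
  obtain ⟨r, c, -, hrsop, hJ⟩ := exists_isRsopPart_append_span_eq (J := J) ha haJ hbm hb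
  -- complete `(a, c, b)` to a regular system of parameters `x = ((a, c, b), y)`
  obtain ⟨e, x, hrank, hspan, hx⟩ := hrsop.exists_rsop
  let y : Fin e → R := fun i => x (Fin.natAdd (p₁ + r + q) i)
  have hxsplit : Set.range x = Set.range (Fin.append (Fin.append a c) b) ∪ Set.range y := by
    have : x = Fin.append (Fin.append (Fin.append a c) b) y := by
      funext i
      refine Fin.addCases (fun j => ?_) (fun k => ?_) i
      · rw [Fin.append_left, hx]
      · rw [Fin.append_right]
    rw [this, range_append']
  -- the adapted presentation: centre part `(a, c)`, transversal part `(b, y)`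
  refine ⟨inferInstance, p₁ + r, q + e, Fin.append a c, Fin.append b y, ?_, ?_, hJ, cc, hcc,
    Or.inl ⟨Fin.append α (fun _ => 0), Fin.append β (fun _ => 0), u, hu, ?_, ?_⟩⟩
  · rw [← hspan, hxsplit]
    congr 1
    simp only [range_append', Set.union_assoc]
  · have h := IsRegularLocalRing.spanFinrank_maximalIdeal (R := R)
    rw [hrank] at h
    rw [← h]
    push_cast
    ring
  · rcases hαβ with ⟨k, hk⟩ | ⟨k, hk⟩
    · exact Or.inl ⟨Fin.castAdd r k, by simpa using hk⟩
    · exact Or.inr ⟨Fin.castAdd e k, by simpa using hk⟩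
  · rw [hX, prod_append_pow, prod_append_pow]
    simp

/-- **Form (2) is clean-permissible for every regular centre**: a unit representative whose residue is not a `p`-th power, at a regular local
ring `R` with `R/J` regular. [cite: Matsumura1987, Thm. 14.2] -/
theorem cleanPermissibleAt_of_unit {R F : Type u} [CommRing R] [IsRegularLocalRing R] [CommRing F] (p : ℕ) (f : R →+* F)
    (G : F) (J : Ideal R) [IsRegularLocalRing (R ⧸ J)] (cc : Fin p → F) (hcc : ∃ j : Fin p, (j : ℕ) ≠ 0 ∧ cc j ≠ 0)
    (u : R) (hu : IsUnit u) (hX : (∑ j : Fin p, cc j ^ p * G ^ (j : ℕ)) = f u) (hup : ∀ c' : R, u - c' ^ p ∉ maximalIdeal R) :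
    CleanPermissibleAt p f G J := by
  classical
  have ha : IsRsopPart (Fin.elim0 : Fin 0 → R) :=
    ⟨inferInstance, (maximalIdeal R).spanFinrank, Classical.choose (exists_regularSystemOfParameters (R := R)), by
      rw [zero_add]; exact (IsRegularLocalRing.spanFinrank_maximalIdeal (R := R)).symm, by
      rw [Set.range_eq_empty Fin.elim0, Set.empty_union]
      exact Classical.choose_spec (exists_regularSystemOfParameters (R := R))⟩
  haveI : IsLocalRing (R ⧸ J) := inferInstance
  have hb : IsRsopPart (Ideal.Quotient.mk J ∘ (Fin.elim0 : Fin 0 → R)) :=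
    ⟨inferInstance, (maximalIdeal (R ⧸ J)).spanFinrank, Classical.choose (exists_regularSystemOfParameters (R := R ⧸ J)), by
      rw [zero_add]; exact (IsRegularLocalRing.spanFinrank_maximalIdeal (R := R ⧸ J)).symm, by
      rw [show Set.range (Ideal.Quotient.mk J ∘ (Fin.elim0 : Fin 0 → R)) = ∅ from Set.range_eq_empty _, Set.empty_union]
      exact Classical.choose_spec (exists_regularSystemOfParameters (R := R ⧸ J))⟩
  obtain ⟨r, c, -, hrsop, hJ⟩ := exists_isRsopPart_append_span_eq (J := J) ha (fun k => Fin.elim0 k) (fun k => Fin.elim0 k) hb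
  obtain ⟨e, x, hrank, hspan, hx⟩ := hrsop.exists_rsop
  let y : Fin e → R := fun i => x (Fin.natAdd (0 + r + 0) i)
  have hxsplit : Set.range x = Set.range (Fin.append (Fin.append Fin.elim0 c) Fin.elim0) ∪ Set.range y := by
    have : x = Fin.append (Fin.append (Fin.append Fin.elim0 c) Fin.elim0) y := by
      funext i
      refine Fin.addCases (fun j => ?_) (fun k => ?_) i
      · rw [Fin.append_left, hx]
      · rw [Fin.append_right]
    rw [this, range_append']
  refine ⟨inferInstance, 0 + r, 0 + e, Fin.append Fin.elim0 c, Fin.append Fin.elim0 y, ?_, ?_, hJ, cc, hcc,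
    Or.inr ⟨u, hu, hX, hup⟩⟩
  · rw [← hspan, hxsplit]
    congr 1
    simp only [range_append', Set.union_assoc]
  · have h := IsRegularLocalRing.spanFinrank_maximalIdeal (R := R)
    rw [hrank] at h
    rw [← h]
    push_cast
    ring

end Summit.ResolutionOfSingularities.ResolutionOfSingularities.Theorems.RadicialJung.CleanModels

end
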